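import Literature.AlgebraicGeometry.Frobenioids.Thm42iiAndiiiGeneralWeak
import Literature.AlgebraicGeometry.Frobenioids.EquivalencePreStepsFSMType
import Literature.AlgebraicGeometry.Frobenioids.EquivalencePreStepsPerfect
import HarnessLib

/-!
# [FrdI] Theorem 4.2 (i)(ii)(iii) AS TYPED over WEAKLY perf-factorial divisor monoids — the forms with NO
# Thm. 3.4 (ii) hypothesis: bases of FSM-type (2008), and Frobenioids of perfect type (hypotheses as printed)

Mochizuki, *The geometry of Frobenioids I: the general theory*, Kyushu J. Math. **62** (2008) 293–400, §4,
Theorem 4.2 p. 77 [cite: MochizukiFrdI2008, Thm. 4.2 (i) p.77]; Thm. 3.4 (ii) p. 62 — pre-steps are preserved over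
bases of FSM-type (`FrdI.isPreStep_map_of_isOfFSMType`, seat abc-iut-L1-t13) and, for Frobenioids of PERFECT isotropic
type, over the printed (2008) FSMFF bases of standard type (d) (`FrdI.isPreStep_map_of_isOfPerfectType`, seat
abc-iut-w4-d093) [cite: MochizukiFrdI2008, Thm. 3.4 (ii) p.62].

PROOF-ONLY file (cell abc-iut, layer L1, node `FrdI:Thm4.2`; seat abc-iut-L1-t12, row «Thm. 4.2 chain over
`IsPerfFactorialWeak`», L1-lead R129; request of abc-iut-L2-d2).  The weak-hypothesis chain
(`Thm42PrimaryStepsGeneralWeak`, `Thm42OfPreStepsGeneralWeak`, `Thm42iiWeak`, `Thm42iiAndiiiGeneralWeak`) proves the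
typed Thm. 4.2 (i)(ii)(iii) for `Φ_i` WEAKLY perf-factorial MODULO "`Ψ`, `Ψ⁻¹` preserve pre-steps".  Here that input
is DISCHARGED in the two regimes where the tree proves it unconditionally, giving the weak twins of
`FrdI.T42.thm42i/ii_ofFunctor_of_isOfFSMType` (seats abc-iut-w5-d162 / L1-d9) and of
`PreFrobenioidData.thm42i/ii_of_perfectType_asPrinted` (seat abc-iut-w4-d093):
* `FrdI.T42.isPrimaryPreStep_map_of_isOfFSMType_weak` / `…inverse_map…` — exactly the binders `hprim`/`hprim'` of
  abc-iut-L2-d2's `cor38_iii_ofRlfZWeak_of_isOfFSMType(_of_countable…)` ([EtTh] Cor. 3.8 (iii) over FSM-type bases);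
* `FrdI.T42.thm42i/ii/ii_iii_ofFunctor_of_isOfFSMType_weak` — bases of FSM-type (2008 sense);
* `FrdI.T42.thm42i/ii_ii_iii_of_perfectType_asPrinted_weak` — Frobenioids of PERFECT type, hypotheses as printed.
No new definitions; no landed declaration touched; nothing of the paper restated or strengthened.  HONEST FRAMING:
classical [FrdI] §4 algebra; nothing here bears on [IUTchIII] Cor. 3.12.
-/

namespace Literature.AlgebraicGeometry.Frobenioids

namespace FrdI.T42

open CategoryTheory Opposite PreFrobenioidData

universe w v v' u u'

variable {D₁ : Type u} [Category.{v} D₁] {Φ₁ : D₁ᵒᵖ ⥤ CommMonCat.{w}} {C₁ : Type u'} [Category.{v'} C₁]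
  {D₂ : Type u} [Category.{v} D₂] {Φ₂ : D₂ᵒᵖ ⥤ CommMonCat.{w}} {C₂ : Type u'} [Category.{v'} C₂]
  {F₁ : C₁ ⥤ ElemFrobenioid Φ₁} {F₂ : C₂ ⥤ ElemFrobenioid Φ₂} (Ψ : C₁ ≌ C₂)

/-! ### Bases of FSM-type (2008): Thm. 3.4 (ii) unconditional (`FrdI.isPreStep_map_of_isOfFSMType`) -/

/-- **Thm. 4.2 (i), primary steps, over bases of FSM-type, `Φ_i` WEAKLY perf-factorial, `C_i` not assumed of
perfect type**: under the typed `Thm42Setting`, `Ψ` preserves primary pre-steps — the binder `hprim` of the cell's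
[EtTh] Cor. 3.8 (iii) weak discharge over FSM-type bases. [cite: MochizukiFrdI2008, Thm. 4.2 (i) p.77] -/
theorem isPrimaryPreStep_map_of_isOfFSMType_weak (hF₁ : PreFrobenioid.IsFrobenioid F₁)
    (hF₂ : PreFrobenioid.IsFrobenioid F₂)
    (hpf₁ : Objectwise (fun M _ => IsPerfFactorialWeak M) Φ₁)
    (hpf₂ : Objectwise (fun M _ => IsPerfFactorialWeak M) Φ₂)
    (hD₁ : IsOfFSMType D₁) (hD₂ : IsOfFSMType D₂) (hT : Thm42Setting (ofFunctor Φ₁ F₁) (ofFunctor Φ₂ F₂))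
    ⦃X Y : C₁⦄ (φ : X ⟶ Y) (hφ : PreFrobenioid.IsPrimaryPreStep F₁ φ) :
    PreFrobenioid.IsPrimaryPreStep F₂ (Ψ.functor.map φ) := by
  obtain ⟨hi₁, hi₂, -, -, -, -⟩ := of_thm42Setting hT
  exact isPrimaryPreStep_map_of_preservesPreSteps_weak Ψ hF₁ hF₂ hpf₁ hpf₂
    (fun _ _ _ h => FrdI.isPreStep_map_of_isOfFSMType hF₁ hF₂ hi₁ hi₂ hD₂ Ψ h)
    (fun _ _ _ h => FrdI.isPreStep_map_of_isOfFSMType hF₂ hF₁ hi₂ hi₁ hD₁ Ψ.symm h) hT φ hφ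

/-- … and `Ψ⁻¹` preserves primary pre-steps (the binder `hprim'`). [cite: MochizukiFrdI2008, Thm. 4.2 (i) p.77] -/
theorem isPrimaryPreStep_inverse_map_of_isOfFSMType_weak (hF₁ : PreFrobenioid.IsFrobenioid F₁)
    (hF₂ : PreFrobenioid.IsFrobenioid F₂)
    (hpf₁ : Objectwise (fun M _ => IsPerfFactorialWeak M) Φ₁)
    (hpf₂ : Objectwise (fun M _ => IsPerfFactorialWeak M) Φ₂)
    (hD₁ : IsOfFSMType D₁) (hD₂ : IsOfFSMType D₂) (hT : Thm42Setting (ofFunctor Φ₁ F₁) (ofFunctor Φ₂ F₂))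
    ⦃X Y : C₂⦄ (φ : X ⟶ Y) (hφ : PreFrobenioid.IsPrimaryPreStep F₂ φ) :
    PreFrobenioid.IsPrimaryPreStep F₁ (Ψ.inverse.map φ) := by
  obtain ⟨hi₁, hi₂, -, -, -, -⟩ := of_thm42Setting hT
  exact isPrimaryPreStep_inverse_map_of_preservesPreSteps_weak Ψ hF₁ hF₂ hpf₁ hpf₂
    (fun _ _ _ h => FrdI.isPreStep_map_of_isOfFSMType hF₁ hF₂ hi₁ hi₂ hD₂ Ψ h)
    (fun _ _ _ h => FrdI.isPreStep_map_of_isOfFSMType hF₂ hF₁ hi₂ hi₁ hD₁ Ψ.symm h) hT φ hφ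

/-- **Theorem 4.2 (i) AS TYPED over bases of FSM-type, `Φ_i` WEAKLY perf-factorial** — weak twin of
`thm42i_ofFunctor_of_isOfFSMType`. [cite: MochizukiFrdI2008, Thm. 4.2 (i) p.77] -/
theorem thm42i_ofFunctor_of_isOfFSMType_weak (hF₁ : PreFrobenioid.IsFrobenioid F₁)
    (hF₂ : PreFrobenioid.IsFrobenioid F₂)
    (hpf₁ : Objectwise (fun M _ => IsPerfFactorialWeak M) Φ₁)
    (hpf₂ : Objectwise (fun M _ => IsPerfFactorialWeak M) Φ₂)
    (hD₁ : IsOfFSMType D₁) (hD₂ : IsOfFSMType D₂) :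
    (ofFunctor Φ₁ F₁).Thm42i (ofFunctor Φ₂ F₂) Ψ := fun hT =>
  have hi := of_thm42Setting hT
  thm42i_ofFunctor_of_preservesPreSteps_weak Ψ hF₁ hF₂ hpf₁ hpf₂
    (fun _ _ _ h => FrdI.isPreStep_map_of_isOfFSMType hF₁ hF₂ hi.1 hi.2.1 hD₂ Ψ h)
    (fun _ _ _ h => FrdI.isPreStep_map_of_isOfFSMType hF₂ hF₁ hi.2.1 hi.1 hD₁ Ψ.symm h) hT

/-- **Theorem 4.2 (ii) AS TYPED over bases of FSM-type, `Φ_i` WEAKLY perf-factorial** — weak twin of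
`thm42ii_ofFunctor_of_isOfFSMType`. [cite: MochizukiFrdI2008, Thm. 4.2 (ii) p.77] -/
theorem thm42ii_ofFunctor_of_isOfFSMType_weak (hF₁ : PreFrobenioid.IsFrobenioid F₁)
    (hF₂ : PreFrobenioid.IsFrobenioid F₂)
    (hpf₁ : Objectwise (fun M _ => IsPerfFactorialWeak M) Φ₁)
    (hpf₂ : Objectwise (fun M _ => IsPerfFactorialWeak M) Φ₂)
    (hD₁ : IsOfFSMType D₁) (hD₂ : IsOfFSMType D₂) :
    (ofFunctor Φ₁ F₁).Thm42ii (ofFunctor Φ₂ F₂) Ψ := fun hT =>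
  have hi := of_thm42Setting hT
  thm42ii_ofFunctor_of_preservesPreSteps_weak Ψ hF₁ hF₂ hpf₁ hpf₂
    (fun _ _ _ h => FrdI.isPreStep_map_of_isOfFSMType hF₁ hF₂ hi.1 hi.2.1 hD₂ Ψ h)
    (fun _ _ _ h => FrdI.isPreStep_map_of_isOfFSMType hF₂ hF₁ hi.2.1 hi.1 hD₁ Ψ.symm h) hT

/-- **Theorem 4.2 (ii) and (iii) together over bases of FSM-type, `Φ_i` WEAKLY perf-factorial**: THE family of (ii)
exists and the monoid isomorphisms of (iii) hold for it. [cite: MochizukiFrdI2008, Thm. 4.2 (iii) p.78] -/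
theorem thm42ii_iii_ofFunctor_of_isOfFSMType_weak (hF₁ : PreFrobenioid.IsFrobenioid F₁)
    (hF₂ : PreFrobenioid.IsFrobenioid F₂)
    (hpf₁ : Objectwise (fun M _ => IsPerfFactorialWeak M) Φ₁)
    (hpf₂ : Objectwise (fun M _ => IsPerfFactorialWeak M) Φ₂)
    (hD₁ : IsOfFSMType D₁) (hD₂ : IsOfFSMType D₂) (hT : Thm42Setting (ofFunctor Φ₁ F₁) (ofFunctor Φ₂ F₂)) :
    ∃ e : ∀ A : C₁, Primes (Φ₁.obj (op (PreFrobenioid.baseObj F₁ A))) ≃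
        Primes (Φ₂.obj (op (PreFrobenioid.baseObj F₂ (Ψ.functor.obj A)))),
      (∀ (A : C₁) (𝔭 : Primes (Φ₁.obj (op (PreFrobenioid.baseObj F₁ A)))),
        (∀ ⦃B : C₁⦄ (φ : A ⟶ B), PreFrobenioid.IsCoAngularPreStep F₁ φ →
            (PreFrobenioid.Div F₁ φ ∈ 𝔭.submonoid ↔
              PreFrobenioid.Div F₂ (Ψ.functor.map φ) ∈ (e A 𝔭).submonoid)) ∧
          ∀ ⦃B : C₁⦄ (ψ : B ⟶ A), PreFrobenioid.IsCoAngularPreStep F₁ ψ →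
            ((∃ y ∈ 𝔭.submonoid, Frobenioids.pull Φ₁ (PreFrobenioid.Base F₁ ψ) y = PreFrobenioid.Div F₁ ψ) ↔
              ∃ y ∈ (e A 𝔭).submonoid, Frobenioids.pull Φ₂ (PreFrobenioid.Base F₂ (Ψ.functor.map ψ)) y =
                PreFrobenioid.Div F₂ (Ψ.functor.map ψ))) ∧
      (ofFunctor Φ₁ F₁).Thm42iii (ofFunctor Φ₂ F₂) Ψ e :=
  have hi := of_thm42Setting hT
  thm42ii_iii_ofFunctor_of_preservesPreSteps_weak Ψ hF₁ hF₂ hpf₁ hpf₂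
    (fun _ _ _ h => FrdI.isPreStep_map_of_isOfFSMType hF₁ hF₂ hi.1 hi.2.1 hD₂ Ψ h)
    (fun _ _ _ h => FrdI.isPreStep_map_of_isOfFSMType hF₂ hF₁ hi.2.1 hi.1 hD₁ Ψ.symm h) hT

/-! ### Frobenioids of perfect type, hypotheses as printed (`FrdI.isPreStep_map_of_isOfPerfectType`) -/

/-- **Theorem 4.2 (i) AS TYPED, perfect-type case, hypotheses as printed, `Φ_i` WEAKLY perf-factorial** — NO
Thm. 3.4 hypothesis and no base hypothesis beyond `Thm42Setting` (pre-steps over the 2008 FSMFF bases of standard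
type (d)); weak twin of `thm42i_of_perfectType_asPrinted` (seat abc-iut-w4-d093).
[cite: MochizukiFrdI2008, Thm. 4.2 (i) p.77] -/
theorem thm42i_of_perfectType_asPrinted_weak (hF₁ : PreFrobenioid.IsFrobenioid F₁)
    (hF₂ : PreFrobenioid.IsFrobenioid F₂) (hperf₁ : PreFrobenioid.IsOfPerfectType F₁)
    (hperf₂ : PreFrobenioid.IsOfPerfectType F₂)
    (hpf₁ : Objectwise (fun M _ => IsPerfFactorialWeak M) Φ₁)
    (hpf₂ : Objectwise (fun M _ => IsPerfFactorialWeak M) Φ₂) :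
    (ofFunctor Φ₁ F₁).Thm42i (ofFunctor Φ₂ F₂) Ψ := fun hT =>
  have hi := of_thm42Setting hT
  thm42i_ofFunctor_of_preservesPreSteps_weak Ψ hF₁ hF₂ hpf₁ hpf₂
    (fun _ _ _ h => FrdI.isPreStep_map_of_isOfPerfectType hF₁ hF₂ hi.1 hi.2.1 hperf₁ hT.standard.2.fsmff Ψ h)
    (fun _ _ _ h =>
      FrdI.isPreStep_map_of_isOfPerfectType hF₂ hF₁ hi.2.1 hi.1 hperf₂ hT.standard.1.fsmff Ψ.symm h) hT

/-- **Theorem 4.2 (ii) AS TYPED, perfect-type case, hypotheses as printed, `Φ_i` WEAKLY perf-factorial** — weak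
twin of `thm42ii_of_perfectType_asPrinted`. [cite: MochizukiFrdI2008, Thm. 4.2 (ii) p.77] -/
theorem thm42ii_of_perfectType_asPrinted_weak (hF₁ : PreFrobenioid.IsFrobenioid F₁)
    (hF₂ : PreFrobenioid.IsFrobenioid F₂) (hperf₁ : PreFrobenioid.IsOfPerfectType F₁)
    (hperf₂ : PreFrobenioid.IsOfPerfectType F₂)
    (hpf₁ : Objectwise (fun M _ => IsPerfFactorialWeak M) Φ₁)
    (hpf₂ : Objectwise (fun M _ => IsPerfFactorialWeak M) Φ₂) :
    (ofFunctor Φ₁ F₁).Thm42ii (ofFunctor Φ₂ F₂) Ψ := fun hT =>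
  have hi := of_thm42Setting hT
  thm42ii_ofFunctor_of_preservesPreSteps_weak Ψ hF₁ hF₂ hpf₁ hpf₂
    (fun _ _ _ h => FrdI.isPreStep_map_of_isOfPerfectType hF₁ hF₂ hi.1 hi.2.1 hperf₁ hT.standard.2.fsmff Ψ h)
    (fun _ _ _ h =>
      FrdI.isPreStep_map_of_isOfPerfectType hF₂ hF₁ hi.2.1 hi.1 hperf₂ hT.standard.1.fsmff Ψ.symm h) hT

/-- **Theorem 4.2 (ii) and (iii) TOGETHER, perfect-type case, hypotheses as printed, `Φ_i` WEAKLY perf-factorial**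
— weak twin of `thm42ii_iii_of_perfectType_asPrinted`. [cite: MochizukiFrdI2008, Thm. 4.2 (ii)(iii) p.78] -/
theorem thm42ii_iii_of_perfectType_asPrinted_weak (hF₁ : PreFrobenioid.IsFrobenioid F₁)
    (hF₂ : PreFrobenioid.IsFrobenioid F₂) (hperf₁ : PreFrobenioid.IsOfPerfectType F₁)
    (hperf₂ : PreFrobenioid.IsOfPerfectType F₂)
    (hpf₁ : Objectwise (fun M _ => IsPerfFactorialWeak M) Φ₁)
    (hpf₂ : Objectwise (fun M _ => IsPerfFactorialWeak M) Φ₂)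
    (hT : Thm42Setting (ofFunctor Φ₁ F₁) (ofFunctor Φ₂ F₂)) :
    ∃ e : ∀ A : C₁, Primes (Φ₁.obj (op (PreFrobenioid.baseObj F₁ A))) ≃
        Primes (Φ₂.obj (op (PreFrobenioid.baseObj F₂ (Ψ.functor.obj A)))),
      (∀ (A : C₁) (𝔭 : Primes (Φ₁.obj (op (PreFrobenioid.baseObj F₁ A)))),
        (∀ ⦃B : C₁⦄ (φ : A ⟶ B), PreFrobenioid.IsCoAngularPreStep F₁ φ →
            (PreFrobenioid.Div F₁ φ ∈ 𝔭.submonoid ↔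
              PreFrobenioid.Div F₂ (Ψ.functor.map φ) ∈ (e A 𝔭).submonoid)) ∧
          ∀ ⦃B : C₁⦄ (ψ : B ⟶ A), PreFrobenioid.IsCoAngularPreStep F₁ ψ →
            ((∃ y ∈ 𝔭.submonoid, Frobenioids.pull Φ₁ (PreFrobenioid.Base F₁ ψ) y = PreFrobenioid.Div F₁ ψ) ↔
              ∃ y ∈ (e A 𝔭).submonoid, Frobenioids.pull Φ₂ (PreFrobenioid.Base F₂ (Ψ.functor.map ψ)) y =
                PreFrobenioid.Div F₂ (Ψ.functor.map ψ))) ∧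
      (ofFunctor Φ₁ F₁).Thm42iii (ofFunctor Φ₂ F₂) Ψ e :=
  have hi := of_thm42Setting hT
  thm42ii_iii_ofFunctor_of_preservesPreSteps_weak Ψ hF₁ hF₂ hpf₁ hpf₂
    (fun _ _ _ h => FrdI.isPreStep_map_of_isOfPerfectType hF₁ hF₂ hi.1 hi.2.1 hperf₁ hT.standard.2.fsmff Ψ h)
    (fun _ _ _ h =>
      FrdI.isPreStep_map_of_isOfPerfectType hF₂ hF₁ hi.2.1 hi.1 hperf₂ hT.standard.1.fsmff Ψ.symm h) hT

end FrdI.T42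

end Literature.AlgebraicGeometry.Frobenioids
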